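import Summits.QuantumFields.BalabanUV.Beta.GAN24.BornLambdaLetters
import Summits.QuantumFields.BalabanUV.Beta.GAN24.StaircaseFaceDensity

/-!
# `BalabanUV.Beta.GAN24.BornLambdaLettersPoly` — binder row G-an2-4 / (CONV-C), CT-ROUTE, BORNSEC-PLAN v1.1 §0 (c) ∕ §A (Λ-C)(C5) second half:
# **THE SOCKET OF THE Λ-BORN ROW ACCEPTS PER-LINEAGE LETTERS WITH `log`s** — summands with constants `C·(k−i)^p·θ^{k−i}` (the `(k−i)·Lc^{−(k−i)}` of the mixed cells and the
# `(k−i)²·Lc^{−(k−i)}` of the ΔΔ cells, plan §0 (c) ∕ §0′) sum over the birth levels `i < k` to a local stencil family with the `k`-FREE constant `C·p!·θ∕(1−θ)^{p+1}`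

NOT IN PRINT; OUR BOOKKEEPING (G-an2-4 formalisation swarm → CRUX TEAM (2), leaf prover `b2b-balaban-gan24-formalise-leaf-03`, gen 54; INTENT «FACE-DENSITY (C5)» journal
`CLAIMS.log` l.33773, PART 2).  [folklore] bookkeeping over leaf-01 g59's `BornLambdaLetters.locStencil_finset_sum` ∕ `BornLambdaLineage.exists_hBLam_of_letters` ∕
`exists_hX_lam_three`, the owner's `StencilSlotOfShapes.locStencil_mono'`, and this seat's `StaircaseFaceDensity.sum_range_sub_pow_mul_pow_le` BY NAME; 0 `def`, 0 cited facts,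
0 `def … : Prop`, 0 sorry.  HONEST FRAMING (cell contract, verbatim): «discharging `BetaPertH` makes Bałaban's UV stability UNCONDITIONAL — a real constructive-QFT result; it is
NOT the continuum limit and NOT the Clay problem.»  HONEST DEPENDENCY (verbatim): «continuum YM on T⁴ ⇐ BetaPertH ∧ nine spine estimates (0/9 proved); BetaPertH ⇐ (D1) ∧ (D4) ∧
CAP+tail; G-an2-4 gates asym, D1 and NE2/3/4.»

## What (generic `d` unless marked; the summands are EXACTLY those of `BornLambdaLetters.exists_hU_of_geometric` ∕ `exists_hC_of_geometric`)
* §1 **`locStencil_sum_of_polyGeometric`**: summands `i < k` with constants `C·(k−i)^p·θ^{k−i}` (`0 ≤ C`, `0 ≤ θ < 1`, one rate) ⇒ the sum over `i < k` is a local stencil family with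
  constant `C·(p!·θ∕(1−θ)^{p+1})` — uniformly in `k` (`StaircaseFaceDensity.sum_range_sub_pow_mul_pow_le`).
* §2 **`exists_hU_of_polyGeometric`** ∕ **`exists_hC_of_polyGeometric`** — PART 1's letters `hU`, `hC` from per-lineage letters WITH `log`s.
* §3 **`exists_hBLam_of_polyGeometric_three`** (`d = 3`): the Λ-born row from two per-lineage letters `C·(k−i)^q·θ^{k−i}` (undressed) and `C·(k−i)^p·θ^{k−i}` (contact) —
  `BornLambdaLetters.exists_hBLam_of_geometric_three` is the case `p = q = 0`; v1.1 (append-only) **`exists_hBLam_of_geometric_poly_three`**: the MIXED socket — undressed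
  letter GEOMETRIC (the OWNER g21's `BornLambdaUndressedRow.exists_hUg_of_rootedRows` output, as is) × contact letter WITH `log`s (the (C4) count's output, as is).
USE ((C6), owner's successor): the plan's count delivers the contact letter as `(k−i)·Lc^{−(k−i)}` (mixed cells) + `(k−i)²·Lc^{−(k−i)}` (ΔΔ cells); feed it here with `θ = Lc⁻¹`
(or any `θ < 1`) and `p = 2` — no need to pre-absorb the `log`s into a slower rate.
Discharges NO slot letter; NO estimate; 0 wall binders; hB ∕ hS0-comb OPEN (owner's (C6)); NEVER «G-an2-4 closed»; NOT D1, NOT BetaPertH, NOT continuum, NOT Clay.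
-/

noncomputable section

open Finset
open scoped BigOperators
open Literature.MathematicalPhysics.QuantumFieldTheory
open Literature.MathematicalPhysics.QuantumFieldTheory.Balaban1983to89
open Literature.MathematicalPhysics.QuantumFieldTheory.Balaban1983to89.Beta
open ExpKernelCalculus (MKer)
open AffineAveraging (box toSite)
open OneStepResolventKernel (Fib LocStencil)
open BalabanCompositeJets (respStep)
open Summit.QuantumFields.BalabanUV.Beta.HessKerDressedUnits (unitS)
open Summit.QuantumFields.BalabanUV.Beta.GAN24.CombesThomas (sfStep smStep)
open Summit.QuantumFields.BalabanUV.Beta.GAN24.StencilSlotOfShapes (locStencil_mono')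
open Summit.QuantumFields.BalabanUV.Beta.GAN24.Push4Iter (legChain)
open Summit.QuantumFields.BalabanUV.Beta.GAN24.Push3 (push₃)
open Summit.QuantumFields.BalabanUV.Beta.GAN24.RespStepBmDecompExact (respStepBmSeq)
open Summit.QuantumFields.BalabanUV.Beta.GAN24.SrecWilsonSector (bornSecAt)
open Summit.QuantumFields.BalabanUV.Beta.GAN24.SrecBornSector (freshAt)
open Summit.QuantumFields.BalabanUV.Beta.GAN24.BornLambdaLineage (exists_hBLam_of_letters exists_hX_lam_three)
open Summit.QuantumFields.BalabanUV.Beta.GAN24.BornLambdaLetters (locStencil_finset_sum)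
open Summit.QuantumFields.BalabanUV.Beta.GAN24.StaircaseFaceDensity (sum_range_sub_pow_mul_pow_le)

namespace Summit.QuantumFields.BalabanUV.Beta.GAN24.BornLambdaLettersPoly

variable {d : ℕ}

/-! ## §1 Sums over the birth levels with `log`s in the constants -/

/-- [folklore] **A SUM OVER BIRTH LEVELS WITH POLYNOMIAL × GEOMETRIC CONSTANTS IS A LOCAL STENCIL FAMILY WITH A `k`-FREE CONSTANT**: if every summand `i < k` is a local
stencil family with constant `C·(k−i)^p·θ^{k−i}` at the common rate `δ` (`0 ≤ C`, `0 ≤ θ < 1`), then the sum is one with constant `C·(p!·θ∕(1−θ)^{p+1})`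
(`StaircaseFaceDensity.sum_range_sub_pow_mul_pow_le`: `Σ_{i<k} (k−i)^p·θ^{k−i} ≤ p!·θ∕(1−θ)^{p+1}` for every `k`). -/
theorem locStencil_sum_of_polyGeometric {F : ℕ → Fin (d + 1) → (Fin (d + 1) → ℤ) → MKer (d + 1) (Fib d)} {C θ δ : ℝ} (p : ℕ) (hC : 0 ≤ C)
    (hθ0 : 0 ≤ θ) (hθ1 : θ < 1) (k : ℕ) (h : ∀ i, i < k → LocStencil (F i) (C * (((k - i : ℕ) : ℝ) ^ p * θ ^ (k - i))) δ) :
    LocStencil (∑ i ∈ Finset.range k, F i) (C * ((p.factorial : ℝ) * θ / (1 - θ) ^ (p + 1))) δ := by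
  have h1 := locStencil_finset_sum (Finset.range k) (C := fun i => C * (((k - i : ℕ) : ℝ) ^ p * θ ^ (k - i)))
    fun i hi => h i (Finset.mem_range.1 hi)
  have hsum : ∑ i ∈ Finset.range k, C * (((k - i : ℕ) : ℝ) ^ p * θ ^ (k - i)) ≤ C * ((p.factorial : ℝ) * θ / (1 - θ) ^ (p + 1)) := by
    rw [← Finset.mul_sum]
    exact mul_le_mul_of_nonneg_left (sum_range_sub_pow_mul_pow_le hθ0 hθ1 p k) hC
  exact locStencil_mono' h1 hsum le_rfl

/-! ## §2 PART 1's letters `hU`, `hC` from per-lineage letters with `log`s -/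

section Letters

variable {Lc : ℕ} [NeZero Lc]

/-- NOT IN PRINT; OUR BOOKKEEPING.  **THE UNDRESSED-LINEAGE LETTER `hU` FROM A PER-LINEAGE LETTER WITH `log`s**: constants `C·(k−i)^q·θ^{k−i}` per lineage ⇒ the sum over
`i < k` with the `k`-free constant `C·q!·θ∕(1−θ)^{q+1}`. -/
theorem exists_hU_of_polyGeometric (cE cΛ : ℝ) (q : ℕ)
    (hUg : ∃ C θ δ : ℝ, 0 ≤ C ∧ 0 ≤ θ ∧ θ < 1 ∧ 0 < δ ∧ ∀ (rr : Fin (d + 1) → ℕ), rr ∈ box (d + 1) Lc → ∀ k i : ℕ, i < k →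
      LocStencil (fun κ' u' => (cE * (Lc : ℝ) ^ (2 * (d + 1))) ^ (k - i) •
        push₃ (respStep (d := d) (Lc ^ i) (Lc ^ k)) (respStep (d := d) (Lc ^ i) (Lc ^ k)) (respStep (d := d) (Lc ^ i) (Lc ^ k))
          (unitS (sfStep Lc i) (smStep d Lc i) (freshAt Lc (toSite rr) 0 cΛ i)) κ' u') (C * (((k - i : ℕ) : ℝ) ^ q * θ ^ (k - i))) δ) :
    ∃ C δ : ℝ, 0 < δ ∧ ∀ (rr : Fin (d + 1) → ℕ), rr ∈ box (d + 1) Lc → ∀ k : ℕ,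
      LocStencil (∑ i ∈ Finset.range k, fun κ' u' => (cE * (Lc : ℝ) ^ (2 * (d + 1))) ^ (k - i) •
        push₃ (respStep (d := d) (Lc ^ i) (Lc ^ k)) (respStep (d := d) (Lc ^ i) (Lc ^ k)) (respStep (d := d) (Lc ^ i) (Lc ^ k))
          (unitS (sfStep Lc i) (smStep d Lc i) (freshAt Lc (toSite rr) 0 cΛ i)) κ' u') C δ := by
  obtain ⟨C, θ, δ, hC, hθ0, hθ1, hδ, h⟩ := hUg
  exact ⟨C * ((q.factorial : ℝ) * θ / (1 - θ) ^ (q + 1)), δ, hδ, fun rr hrr k =>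
    locStencil_sum_of_polyGeometric q hC hθ0 hθ1 k fun i hi => h rr hrr k i hi⟩

/-- NOT IN PRINT; OUR BOOKKEEPING.  **THE CONTACT LETTER `hC` FROM A PER-LINEAGE LETTER WITH `log`s** (the shape BORNSEC-PLAN v1.1 §0 (c) ∕ §0′ counts: `(k−i)·θ^{k−i}` for the
mixed cells, `(k−i)²·θ^{k−i}` for the ΔΔ cells): constants `C·(k−i)^p·θ^{k−i}` per lineage ⇒ the sum with `C·p!·θ∕(1−θ)^{p+1}`. -/
theorem exists_hC_of_polyGeometric (cE cΛ : ℝ) (p : ℕ)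
    (hCg : ∃ C θ δ : ℝ, 0 ≤ C ∧ 0 ≤ θ ∧ θ < 1 ∧ 0 < δ ∧ ∀ (rr : Fin (d + 1) → ℕ), rr ∈ box (d + 1) Lc → ∀ k i : ℕ, i < k →
      LocStencil (fun κ' u' => (cE * (Lc : ℝ) ^ (2 * (d + 1))) ^ (k - i) •
        (push₃ (legChain (respStepBmSeq (toSite rr) Lc) i (k - 1 - i)) (legChain (respStepBmSeq (toSite rr) Lc) i (k - 1 - i))
            (legChain (respStepBmSeq (toSite rr) Lc) i (k - 1 - i)) (unitS (sfStep Lc i) (smStep d Lc i) (freshAt Lc (toSite rr) 0 cΛ i)) κ' u'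
          - push₃ (respStep (d := d) (Lc ^ i) (Lc ^ k)) (respStep (d := d) (Lc ^ i) (Lc ^ k)) (respStep (d := d) (Lc ^ i) (Lc ^ k))
            (unitS (sfStep Lc i) (smStep d Lc i) (freshAt Lc (toSite rr) 0 cΛ i)) κ' u')) (C * (((k - i : ℕ) : ℝ) ^ p * θ ^ (k - i))) δ) :
    ∃ C δ : ℝ, 0 < δ ∧ ∀ (rr : Fin (d + 1) → ℕ), rr ∈ box (d + 1) Lc → ∀ k : ℕ,
      LocStencil (∑ i ∈ Finset.range k, fun κ' u' => (cE * (Lc : ℝ) ^ (2 * (d + 1))) ^ (k - i) •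
        (push₃ (legChain (respStepBmSeq (toSite rr) Lc) i (k - 1 - i)) (legChain (respStepBmSeq (toSite rr) Lc) i (k - 1 - i))
            (legChain (respStepBmSeq (toSite rr) Lc) i (k - 1 - i)) (unitS (sfStep Lc i) (smStep d Lc i) (freshAt Lc (toSite rr) 0 cΛ i)) κ' u'
          - push₃ (respStep (d := d) (Lc ^ i) (Lc ^ k)) (respStep (d := d) (Lc ^ i) (Lc ^ k)) (respStep (d := d) (Lc ^ i) (Lc ^ k))
            (unitS (sfStep Lc i) (smStep d Lc i) (freshAt Lc (toSite rr) 0 cΛ i)) κ' u')) C δ := by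
  obtain ⟨C, θ, δ, hC, hθ0, hθ1, hδ, h⟩ := hCg
  exact ⟨C * ((p.factorial : ℝ) * θ / (1 - θ) ^ (p + 1)), δ, hδ, fun rr hrr k =>
    locStencil_sum_of_polyGeometric p hC hθ0 hθ1 k fun i hi => h rr hrr k i hi⟩

end Letters

/-! ## §3 The Λ-born row of the `d = 3` family from two per-lineage letters with `log`s -/

/-- NOT IN PRINT; OUR BOOKKEEPING ((V8) Λ half, END SHAPE at `d = 3`, `log`s ALLOWED).  **THE Λ-BORN ROW OF THE `d = 3` FAMILY FROM TWO PER-LINEAGE LETTERS WITH `log`s**: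
undressed lineages `≤ C·(k−i)^q·θ^{k−i}` and contact terms `≤ C·(k−i)^p·θ^{k−i}` in `LocStencil` form (one rate each, uniform in the in-block root) give `hB(0, cΛ)`;
`hX` is leaf-01's `exists_hX_lam_three`.  `BornLambdaLetters.exists_hBLam_of_geometric_three` is the case `p = q = 0`.  Nothing of the two letters is claimed here. -/
theorem exists_hBLam_of_polyGeometric_three {Lc : ℕ} [NeZero Lc] (cE cΛ : ℝ) (q p : ℕ)
    (hUg : ∃ C θ δ : ℝ, 0 ≤ C ∧ 0 ≤ θ ∧ θ < 1 ∧ 0 < δ ∧ ∀ (rr : Fin (3 + 1) → ℕ), rr ∈ box (3 + 1) Lc → ∀ k i : ℕ, i < k →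
      LocStencil (fun κ' u' => (cE * (Lc : ℝ) ^ (2 * (3 + 1))) ^ (k - i) •
        push₃ (respStep (d := 3) (Lc ^ i) (Lc ^ k)) (respStep (d := 3) (Lc ^ i) (Lc ^ k)) (respStep (d := 3) (Lc ^ i) (Lc ^ k))
          (unitS (sfStep Lc i) (smStep 3 Lc i) (freshAt Lc (toSite rr) 0 cΛ i)) κ' u') (C * (((k - i : ℕ) : ℝ) ^ q * θ ^ (k - i))) δ)
    (hCg : ∃ C θ δ : ℝ, 0 ≤ C ∧ 0 ≤ θ ∧ θ < 1 ∧ 0 < δ ∧ ∀ (rr : Fin (3 + 1) → ℕ), rr ∈ box (3 + 1) Lc → ∀ k i : ℕ, i < k →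
      LocStencil (fun κ' u' => (cE * (Lc : ℝ) ^ (2 * (3 + 1))) ^ (k - i) •
        (push₃ (legChain (respStepBmSeq (toSite rr) Lc) i (k - 1 - i)) (legChain (respStepBmSeq (toSite rr) Lc) i (k - 1 - i))
            (legChain (respStepBmSeq (toSite rr) Lc) i (k - 1 - i)) (unitS (sfStep Lc i) (smStep 3 Lc i) (freshAt Lc (toSite rr) 0 cΛ i)) κ' u'
          - push₃ (respStep (d := 3) (Lc ^ i) (Lc ^ k)) (respStep (d := 3) (Lc ^ i) (Lc ^ k)) (respStep (d := 3) (Lc ^ i) (Lc ^ k))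
            (unitS (sfStep Lc i) (smStep 3 Lc i) (freshAt Lc (toSite rr) 0 cΛ i)) κ' u')) (C * (((k - i : ℕ) : ℝ) ^ p * θ ^ (k - i))) δ) :
    ∃ C δ : ℝ, 0 < δ ∧ ∀ (rr : Fin (3 + 1) → ℕ), rr ∈ box (3 + 1) Lc →
      ∀ k : ℕ, LocStencil (unitS (sfStep Lc k) (smStep 3 Lc k) (bornSecAt Lc (toSite rr) cE 0 cΛ k)) C δ :=
  exists_hBLam_of_letters (d := 3) cE cΛ (exists_hX_lam_three cΛ) (exists_hU_of_polyGeometric (d := 3) cE cΛ q hUg)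
    (exists_hC_of_polyGeometric (d := 3) cE cΛ p hCg)

/-- NOT IN PRINT; OUR BOOKKEEPING ((V8) Λ half, END SHAPE at `d = 3`, MIXED letters).  **THE Λ-BORN ROW OF THE `d = 3` FAMILY FROM A GEOMETRIC UNDRESSED LETTER AND A CONTACT
LETTER WITH `log`s** — the socket on which the OWNER g21's `BornLambdaUndressedRow.exists_hUg_of_rootedRows` (undressed lineages `≤ C·θ^{k−i}`, road S3's rooted rows) and the
(C4) count (contact terms `≤ C·(k−i)^p·θ^{k−i}`, `p = 1` from `StaircaseFaceDensity.tsum_abs_mul_le_of_faceLetter`'s one factor `n = k−1−i`; `p = 2` if the ΔΔ cell is kept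
separate) plug in WITHOUT any rate conversion on either side. -/
theorem exists_hBLam_of_geometric_poly_three {Lc : ℕ} [NeZero Lc] (cE cΛ : ℝ) (p : ℕ)
    (hUg : ∃ C θ δ : ℝ, 0 ≤ C ∧ 0 ≤ θ ∧ θ < 1 ∧ 0 < δ ∧ ∀ (rr : Fin (3 + 1) → ℕ), rr ∈ box (3 + 1) Lc → ∀ k i : ℕ, i < k →
      LocStencil (fun κ' u' => (cE * (Lc : ℝ) ^ (2 * (3 + 1))) ^ (k - i) •
        push₃ (respStep (d := 3) (Lc ^ i) (Lc ^ k)) (respStep (d := 3) (Lc ^ i) (Lc ^ k)) (respStep (d := 3) (Lc ^ i) (Lc ^ k))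
          (unitS (sfStep Lc i) (smStep 3 Lc i) (freshAt Lc (toSite rr) 0 cΛ i)) κ' u') (C * θ ^ (k - i)) δ)
    (hCg : ∃ C θ δ : ℝ, 0 ≤ C ∧ 0 ≤ θ ∧ θ < 1 ∧ 0 < δ ∧ ∀ (rr : Fin (3 + 1) → ℕ), rr ∈ box (3 + 1) Lc → ∀ k i : ℕ, i < k →
      LocStencil (fun κ' u' => (cE * (Lc : ℝ) ^ (2 * (3 + 1))) ^ (k - i) •
        (push₃ (legChain (respStepBmSeq (toSite rr) Lc) i (k - 1 - i)) (legChain (respStepBmSeq (toSite rr) Lc) i (k - 1 - i))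
            (legChain (respStepBmSeq (toSite rr) Lc) i (k - 1 - i)) (unitS (sfStep Lc i) (smStep 3 Lc i) (freshAt Lc (toSite rr) 0 cΛ i)) κ' u'
          - push₃ (respStep (d := 3) (Lc ^ i) (Lc ^ k)) (respStep (d := 3) (Lc ^ i) (Lc ^ k)) (respStep (d := 3) (Lc ^ i) (Lc ^ k))
            (unitS (sfStep Lc i) (smStep 3 Lc i) (freshAt Lc (toSite rr) 0 cΛ i)) κ' u')) (C * (((k - i : ℕ) : ℝ) ^ p * θ ^ (k - i))) δ) :
    ∃ C δ : ℝ, 0 < δ ∧ ∀ (rr : Fin (3 + 1) → ℕ), rr ∈ box (3 + 1) Lc →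
      ∀ k : ℕ, LocStencil (unitS (sfStep Lc k) (smStep 3 Lc k) (bornSecAt Lc (toSite rr) cE 0 cΛ k)) C δ :=
  exists_hBLam_of_letters (d := 3) cE cΛ (exists_hX_lam_three cΛ) (BornLambdaLetters.exists_hU_of_geometric (d := 3) cE cΛ hUg)
    (exists_hC_of_polyGeometric (d := 3) cE cΛ p hCg)

end Summit.QuantumFields.BalabanUV.Beta.GAN24.BornLambdaLettersPoly

end
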